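import Summits.Ventures.Crystal3D.Theorems.StickyWulffConstantTextureBuildCellsRefine
import Summits.Ventures.Crystal3D.Theorems.StickyWulffConstantTextureBuildTentCert
import Summits.Ventures.Crystal3D.Theorems.StickyWulffConstantTextureBuildMeshV5
import Summits.Ventures.Crystal3D.Theorems.StickyWulffConstantTextureBuildSlabPieces
import Summits.Ventures.Crystal3D.Theorems.StickyWulffConstantTextureBuildLawData
import HarnessLib

/-!
# TB-D assembly, part 16: the TEXTURE CELLS of a risered cover with a v5 mesh — plane set, bounded family, labelling rule, class frames
# (lane T, crux `TextureLiminfV5`, stmt-Ventures-23912; blueprint HOME/wulff-p2/g20/TB-D-2-g20.md §1 (1a)–(1c); ruling (ccxi)(D) «vocabulary first»)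

HONEST FRAMING. Venture `Summits/Ventures/Crystal3D` (cell `crystal3d-full`), route `route-Ventures-StickyWulffConstant`, helper `--supports` the
law-v5 crux `TextureLiminfV5` (stmt-Ventures-23912).  DEFINITIONS ONLY (the vocabulary in which the remaining lemmas (L-T) (L-P1) (L-P2) (L-C) (L-R)
(L-M) (L-A) of the blueprint are stated) + the unit-normal / boundedness bookkeeping that `refineCells` needs (census-free, standard axioms).  No
classification lemma is proved here; the riser package (B6, tb-w1) enters through the two INPUT fields `extra` (the riser planes) and `boxGrain` (the claim
rule); the cut levels `τ` enter as data (their Cavalieri property, `exists_cut_level`, is a hypothesis of (L-C)).  F-C1 not moved.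

* `TexInput rc μ` — the chosen/external data: certified tents `ct f : TentCert (rc.tent f)` (T0 at canonical frames, …TextureBuildTentCert), cut levels `τ`,
  riser planes `extra` (unit normals) and the box claim rule `boxGrain`;
* `TexInput.cutDatum k` (the cut half-space `⟪M_k e₃, ·⟫ < ⟪M_k e₃, t_k⟫ + τ_k`), `bigSet` (a bounded set containing every mesh polytope and every tent solid),
  `slabWindow f` (the finitely many own slabs of grain `f` meeting it), `slabData`;
* `TexInput.𝓗` (ALL planes: territories, cores, prisms + cut data, gaps, boxes, certificate pieces, own slabs, `extra`) with `𝓗_unit`; `TexInput.𝒢` (the bounded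
  family: territories, cores, prisms, gaps, boxes, certificate pieces) with `𝒢_subset_𝓗`, `𝒢_bounded`;
* `TexInput.Class` (= `Σ f, slabWindow f`, a `Fintype`) and its `Fin n` coding; `grainOf` / `slabOf` / `lab₀` — the LABELLING RULE of the blueprint
  (core ▸ tent ▸ prism below/above the cut ▸ gap ▸ box claim ▸ void);
* `TexInput.cells : LabelledCells := refineCells 𝓗 … lab₀` and the class frames `classFrame` (canonical frame of the class's bilayer) with the law data
  `lawC classFrame`, `lawM classFrame` — the `A, c, m` of the future `PieceData`.
-/

noncomputable section

open scoped BigOperators InnerProductSpace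

namespace Summit.Ventures.Crystal3D.Cruxes.TextureLiminf.TexShadow

open Summit.Ventures.Crystal3D Summit.Ventures.Crystal3D.Theorems MeasureTheory Set
open Summit.Ventures.Crystal3D.TentCertificate (hB)

/-- **INPUT DATA of the texture cells** over a risered cover and a v5 mesh. -/
structure TexInput {C R₀ : ℝ} {N : ℕ} {x : Fin N → E3} (rc : RiseredCover C R₀ N x) {δ : ℝ} (μ : Mesh₅ rc δ) where
  /-- certified tents (T0 certificate at the canonical frames), one per tent piece -/
  ct : (f : Fin rc.ng) → TentCert (rc.tent f)
  /-- cut levels of the prism texture-cells (model heights in `(0,1)`) -/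
  τ : Fin rc.nk → ℝ
  /-- riser planes (supplied by the riser package) -/
  extra : Finset (E3 × ℝ)
  hextra : ∀ p ∈ extra, ‖p.1‖ = 1
  /-- the claim rule inside riser boxes: the column grain claiming the cell with the given positive part -/
  boxGrain : Fin rc.nr → Finset (E3 × ℝ) → Fin rc.ng

namespace TexInput

variable {C R₀ : ℝ} {N : ℕ} {x : Fin N → E3} {rc : RiseredCover C R₀ N x} {δ : ℝ} {μ : Mesh₅ rc δ} (I : TexInput rc μ)

/-! ### Cut data -/

/-- the cut half-space datum of cell `k`: `⟪M_k e₃, y⟫ < ⟪M_k e₃, t_k⟫ + τ_k` (model height `< τ_k`) -/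
def cutDatum (k : Fin rc.nk) : E3 × ℝ := ((rc.cell k).M e₃, ⟪(rc.cell k).M e₃, (rc.cell k).t⟫_ℝ + I.τ k)

/-- The cut datum has a unit normal. -/
theorem norm_cutDatum (k : Fin rc.nk) : ‖(I.cutDatum k).1‖ = 1 := norm_frame_e₃ _

/-- The model height of cell `k` is the inner product with the cut normal, shifted (local copy; the public version is
`CellCover.height_eq_inner_frame` in …CutInput). -/
private theorem height_eq_inner_cut (k : Fin rc.nk) (y : E3) :
    rc.height k y = ⟪(rc.cell k).M e₃, y⟫_ℝ - ⟪(rc.cell k).M e₃, (rc.cell k).t⟫_ℝ := by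
  unfold CellCover.height
  have h : ((rc.cell k).M.symm (y - (rc.cell k).t)) 2 = ⟪e₃, (rc.cell k).M.symm (y - (rc.cell k).t)⟫_ℝ := by
    simp [e₃, EuclideanSpace.inner_single_left]
  rw [h, ← LinearIsometryEquiv.inner_map_map (rc.cell k).M, LinearIsometryEquiv.apply_symm_apply, inner_sub_right]

/-- Below the cut = inside the cut half-space. -/
theorem height_lt_iff (k : Fin rc.nk) (y : E3) : rc.height k y < I.τ k ↔ ⟪(I.cutDatum k).1, y⟫_ℝ < (I.cutDatum k).2 := by
  rw [height_eq_inner_cut]; simp only [cutDatum]; constructor <;> intro h <;> linarith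

/-! ### The bounded ambient set and the slab windows -/

/-- a bounded set containing every mesh polytope and every tent solid -/
def bigSet : Set E3 :=
  ((⋃ f, ⋃ j, polytope (μ.HD f j)) ∪ (⋃ k, polytope (μ.HP k)) ∪ (⋃ l, polytope (μ.HQ l)) ∪ (⋃ r, polytope (μ.HB r))) ∪ ⋃ f, (I.ct f).G

/-- `bigSet` is bounded. -/
theorem isBounded_bigSet : Bornology.IsBounded I.bigSet := by
  unfold bigSet
  refine ((((Bornology.isBounded_iUnion.2 fun f => Bornology.isBounded_iUnion.2 fun j => μ.hDbd f j).union
    (Bornology.isBounded_iUnion.2 fun k => μ.hPbd k)).union (Bornology.isBounded_iUnion.2 fun l => μ.hQbd l)).union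
    (Bornology.isBounded_iUnion.2 fun r => μ.hBbd r)).union (Bornology.isBounded_iUnion.2 fun f => ?_)
  rw [(I.ct f).hG]
  exact Bornology.isBounded_iUnion.2 fun j => (I.ct f).hbd j

/-- the own slabs of grain `f` meeting `bigSet` (finitely many) -/
def slabWindow (f : Fin rc.ng) : Finset ℤ :=
  (finite_slabs_meeting (rc.tent f).L (rc.tent f).s I.isBounded_bigSet).toFinset

/-- Membership in the slab window. -/
theorem mem_slabWindow_iff (f : Fin rc.ng) (i : ℤ) : i ∈ I.slabWindow f ↔ (laySlab (rc.tent f).L (rc.tent f).s i ∩ I.bigSet).Nonempty := by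
  unfold slabWindow; rw [Set.Finite.mem_toFinset]; rfl

/-- the slab constraints of all grains over their windows -/
def slabData : Finset (E3 × ℝ) :=
  Finset.univ.biUnion fun f => (I.slabWindow f).biUnion fun i => laySlabH (rc.tent f).L (rc.tent f).s i

/-! ### The plane set and the bounded family -/

/-- **ALL PLANES** of the texture arrangement. -/
def 𝓗 : Finset (E3 × ℝ) :=
  (Finset.univ.biUnion fun f => Finset.univ.biUnion fun j => μ.HD f j) ∪
  (Finset.univ.biUnion fun f => Finset.univ.biUnion fun j => μ.HC f j) ∪
  (Finset.univ.biUnion fun k => μ.HP k ∪ {I.cutDatum k, antip (I.cutDatum k)}) ∪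
  (Finset.univ.biUnion fun l => μ.HQ l) ∪
  (Finset.univ.biUnion fun r => μ.HB r) ∪
  (Finset.univ.biUnion fun f => Finset.univ.biUnion fun j => (I.ct f).H j) ∪
  I.slabData ∪ I.extra

/-- Every plane of the arrangement has a unit normal. -/
theorem 𝓗_unit : ∀ p ∈ I.𝓗, ‖p.1‖ = 1 := by
  intro p hp
  simp only [𝓗, Finset.mem_union, Finset.mem_biUnion, Finset.mem_univ, true_and, Finset.mem_insert, Finset.mem_singleton,
    slabData] at hp
  rcases hp with ((((((⟨f, j, h⟩ | ⟨f, j, h⟩) | ⟨k, h | h | h⟩) | ⟨l, h⟩) | ⟨r, h⟩) | ⟨f, j, h⟩) | ⟨f, i, -, h⟩) | h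
  · exact μ.hDunit f j p h
  · exact μ.hCunit f j p h
  · exact μ.hPunit k p h
  · rw [h]; exact I.norm_cutDatum k
  · rw [h]; simp only [antip, norm_neg]; exact I.norm_cutDatum k
  · exact μ.hQunit l p h
  · exact μ.hBunit r p h
  · exact (I.ct f).hunit j p h
  · exact laySlabH_unit _ _ i p h
  · exact I.hextra p h

/-- **THE BOUNDED FAMILY**: territories, cores, prisms, gap pieces, riser boxes, certificate pieces. -/
def 𝒢 : Finset (Finset (E3 × ℝ)) :=
  (Finset.univ.biUnion fun f => Finset.univ.image (μ.HD f)) ∪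
  (Finset.univ.biUnion fun f => Finset.univ.image (μ.HC f)) ∪
  Finset.univ.image μ.HP ∪ Finset.univ.image μ.HQ ∪ Finset.univ.image μ.HB ∪
  (Finset.univ.biUnion fun f => Finset.univ.image (I.ct f).H)

/-- Every member of the family is cut out by planes of the arrangement. -/
theorem 𝒢_subset_𝓗 : ∀ G ∈ I.𝒢, G ⊆ I.𝓗 := by
  intro G hG p hp
  simp only [𝒢, Finset.mem_union, Finset.mem_biUnion, Finset.mem_univ, true_and, Finset.mem_image] at hG
  simp only [𝓗, Finset.mem_union, Finset.mem_biUnion, Finset.mem_univ, true_and, Finset.mem_insert, Finset.mem_singleton]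
  rcases hG with ((((⟨f, j, rfl⟩ | ⟨f, j, rfl⟩) | ⟨k, rfl⟩) | ⟨l, rfl⟩) | ⟨r, rfl⟩) | ⟨f, j, rfl⟩
  · exact Or.inl (Or.inl (Or.inl (Or.inl (Or.inl (Or.inl (Or.inl ⟨f, j, hp⟩))))))
  · exact Or.inl (Or.inl (Or.inl (Or.inl (Or.inl (Or.inl (Or.inr ⟨f, j, hp⟩))))))
  · exact Or.inl (Or.inl (Or.inl (Or.inl (Or.inl (Or.inr ⟨k, Or.inl hp⟩)))))
  · exact Or.inl (Or.inl (Or.inl (Or.inl (Or.inr ⟨l, hp⟩))))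
  · exact Or.inl (Or.inl (Or.inl (Or.inr ⟨r, hp⟩)))
  · exact Or.inl (Or.inl (Or.inr ⟨f, j, hp⟩))

/-- Every member of the family is bounded. -/
theorem 𝒢_bounded : ∀ G ∈ I.𝒢, Bornology.IsBounded (polytope G) := by
  intro G hG
  simp only [𝒢, Finset.mem_union, Finset.mem_biUnion, Finset.mem_univ, true_and, Finset.mem_image] at hG
  rcases hG with ((((⟨f, j, rfl⟩ | ⟨f, j, rfl⟩) | ⟨k, rfl⟩) | ⟨l, rfl⟩) | ⟨r, rfl⟩) | ⟨f, j, rfl⟩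
  · exact μ.hDbd f j
  · exact μ.hCbd f j
  · exact μ.hPbd k
  · exact μ.hQbd l
  · exact μ.hBbd r
  · exact (I.ct f).hbd j

/-! ### Classes and the labelling rule -/

/-- the slab-grain classes: a grain and one of its own slabs in the window (a finite sigma type) -/
abbrev Class : Type := Σ f : Fin rc.ng, {i : ℤ // i ∈ I.slabWindow f}

/-- number of classes -/
def n : ℕ := Fintype.card I.Class

/-- the `Fin n` coding of the classes -/
def enc : I.Class ≃ Fin I.n := Fintype.equivFin I.Class

open scoped Classical in
/-- the GRAIN of a cell with positive part `T` (core ▸ tent ▸ prism below/above ▸ gap ▸ box claim ▸ void) -/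
def grainOf (T : Finset (E3 × ℝ)) : Option (Fin rc.ng) :=
  if h : ∃ f : Fin rc.ng, ∃ j, μ.HC f j ⊆ T then some (Classical.choose h)
  else if h : ∃ f : Fin rc.ng, (∃ j, (I.ct f).H j ⊆ T) ∧ ∃ j', μ.HD f j' ⊆ T then some (Classical.choose h)
  else if h : ∃ k : Fin rc.nk, μ.HP k ⊆ T then
    some (if I.cutDatum (Classical.choose h) ∈ T then μ.fk (Classical.choose h) else μ.gk (Classical.choose h))
  else if h : ∃ l : Fin μ.nQ, μ.HQ l ⊆ T then some (μ.lab (Classical.choose h))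
  else if h : ∃ r : Fin rc.nr, μ.HB r ⊆ T then some (I.boxGrain (Classical.choose h) T)
  else none

open scoped Classical in
/-- the OWN SLAB of grain `f` containing the cell with positive part `T`, if its two constraints are in `T` -/
def slabOf (f : Fin rc.ng) (T : Finset (E3 × ℝ)) : Option {i : ℤ // i ∈ I.slabWindow f} :=
  if h : ∃ i : {i : ℤ // i ∈ I.slabWindow f}, laySlabH (rc.tent f).L (rc.tent f).s i.1 ⊆ T then some (Classical.choose h) else none

/-- **THE LABELLING RULE**: class `(grain, own slab)` of a cell, or void. -/
def lab₀ (T : Finset (E3 × ℝ)) : Option (Fin I.n) :=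
  (I.grainOf T).bind fun f => (I.slabOf f T).map fun i => I.enc ⟨f, i⟩

/-! ### The cells and the class frames -/

/-- **THE TEXTURE CELLS**: the labelled cells of the arrangement `𝓗` inside `⋃ 𝒢`. -/
def cells : LabelledCells := refineCells I.𝓗 I.𝓗_unit I.𝒢 I.𝒢_subset_𝓗 I.𝒢_bounded I.n I.lab₀

/-- The cells' class count is `n`. -/
theorem cells_n : I.cells.n = I.n := rfl

/-- the canonical frame of class `c = (f, i)`: the frame of bilayer `i` of grain `f`'s own presentation -/
def classFrame (c : Fin I.n) : E3 ≃ₗᵢ[ℝ] E3 := (rc.tent (I.enc.symm c).1).frame (I.enc.symm c).2.1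

/-- the frames in the cells' own class indexing (`cells.n = n` definitionally) -/
def frameOf (c : Fin I.cells.n) : E3 ≃ₗᵢ[ℝ] E3 := I.classFrame c

/-- the wall charge of the texture between two classes (…TextureBuildLawData) -/
def charge (c c' : Fin I.cells.n) : ℝ := lawC I.frameOf c c'

/-- the wall axis of the texture between two classes -/
def axis (c c' : Fin I.cells.n) : E3 := lawM I.frameOf c c'

/-- The law clauses of `PieceData` hold for the class frames (re-export of …TextureBuildLawData). -/
theorem charge_nonneg (c c' : Fin I.cells.n) : 0 ≤ I.charge c c' := lawC_nonneg _ _ _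

/-- Two classes of ONE grain share the grain's stacking axis (all same-grain contacts are free, `lawW_eq_zero_of_sharedAxis`). -/
theorem sharedAxis_classFrame_of_grain_eq {c c' : Fin I.n} (h : (I.enc.symm c).1 = (I.enc.symm c').1) :
    SharedAxis ((rc.tent (I.enc.symm c).1).L e₃) (I.classFrame c) (I.classFrame c') := by
  unfold classFrame
  generalize (I.enc.symm c').2.1 = z
  rw [← h]
  exact (rc.tent (I.enc.symm c).1).sharedAxis_frame _ _

end TexInput

end Summit.Ventures.Crystal3D.Cruxes.TextureLiminf.TexShadow

end
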